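import Literature.IUT.LogThetaLattice.PacketLogVolumesHaarModelRelativeTensorDegree
import Literature.IUT.LogThetaLattice.PacketLogVolumesHaarModelCapsulesSingleton
import HarnessLib

/-!
# [IUTchIII] Proposition 3.9 (iii) for CAPSULES at the RELATIVE genuine model, degree clause for EVERY capsule size:
# `μ^log_{A,𝕍_ℚ}(𝔍) = deg_{F_mod}(𝔍)/[F_mod:ℚ]` in the `A`-packets `⊕_{(v_β)} ⊗_β K_{v̲_β}` of `K ⊋ F_mod` for every finite
# nonempty `A`, `|A| = 1` included (abc-iut cell, layer L6; rows REL39 part R3 / CAP39 part VIII, abc-iut-L6-d3)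

S. Mochizuki, *Inter-universal Teichmüller theory III*, kurims manuscript (May 2020), Proposition 3.9 (i) p. 115 ("for
`A` a finite nonempty set … when `|A| = 1` … we write `μ^log_{α,v_ℚ}`") and (iii) p. 117 ("the global log-volume
`μ^log_{A,𝕍_ℚ}(𝔍)` is equal to the degree of the arithmetic line bundle determined by `𝔍` …, relative to a suitable
normalization"); Remark 3.9.2 (relative case `K ⊋ F_mod`, `𝕍 = V̲ ⥲ 𝕍_mod`). [claim: Mochizuki2012, status: disputed]

WHAT THIS FILE ADDS. abc-iut-w5-d083's `PacketLogVolumesHaarModelRelativeTensorDegree.lean` (p422500, row REL39 part R3)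
proves the degree clause at the RELATIVE genuine `A`-packets under `hA : 2 ≤ |A|`, the hypothesis inherited (through
abc-iut-L6-d3's p419946) from campaign-S's typing of [IUTchIV] Prop. 1.1. abc-iut-L6-d3's part VIII
(`PacketLogVolumesHaarModelCapsulesSingleton.lean`, p426201) removed it in the absolute case: the integral structure
`(R_I)^∼` of a tensor packet is compact for EVERY `|I| ≥ 1` (`normalizedIntegralStructure`, `integralPortionRegion`). This
file is the same removal for the relative portions `⊗_β K_{v̲_β}` — a transcription of p422500 with d3's `hA`-free
regions on the `K`-slots, nothing else changed:
* `relIdealCapsuleRegionAt σ τ A α 𝔍 q π` / `relIdealCapsuleRegion` — the region of `𝔍` in the label `α` (`ι_α(ϖ_{v_α}^{-n})·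
  (R_I)^∼_K` at `p`, the dilated polydisc at `∞`), for every finite nonempty `A`; `= p422500's relCapsuleIdealRegion …
  hA` whenever `2 ≤ |A|` (`relCapsuleIdealRegion_eq_relIdealCapsuleRegion`);
* `relPortionDatum_logVol_relIdealCapsuleRegionAt` (= d3's `idealTerm`), `relCapsulePacketLogVolume_relIdealCapsuleRegionAt`
  (= p416411's `haarPacketLogVolume F q (haarIdealRegion F 𝔍)`, and = the absolute capsule value of part VIII),
  `globalLogVolume_relIdealCapsuleRegion (= deg/[F:ℚ])`, `_eq_ndeg`, `_unit`;
* **`prop39iii_degree_haarModelRelCapsules_allSizes σ τ A α : Prop39iii_degree (relCapsulePacketLogVolume σ τ A)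
  (relIdealCapsuleRegion σ τ A α) IdealFamily.deg`** with `c = 1/[F_mod:ℚ]` for EVERY `K ⊇ F_mod`, section, finite
  nonempty `A` and label; `exists_…`; both clauses together.

HONEST SCOPE. As p422500 (objects `𝔍` = families of fractional ideals of `F_mod` / dilated discs; `⊗_ℝ` of copies of `ℂ`
at `∞`, faithful for totally complex `K`; dimension-normalised log-volumes). Nothing here bears on [IUTchIII] Cor. 3.12
or takes a side; typed ≠ endorsed. Classical. [cite: DupuyHilado2025, §3.7]
-/

noncomputable section

namespace Literature.IUT.LogThetaLattice

open Literature.IUT.LogVolume Literature.NumberTheory.NumberFields NumberField IsDedekindDomain MeasureTheory Set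
open scoped ENNReal NNReal


variable {F K : Type} [Field F] [NumberField F] [Field K] [NumberField K] [Algebra F K]
  (σ : PlaceSection F K) (τ : InfinitePlace F → InfinitePlace K) (hτ : ∀ w, (τ w).comap (algebraMap F K) = w)
variable (A : Type) [Fintype A] [DecidableEq A] [Nonempty A]

/-! ### The region of `𝔍` in the label `α` of the relative portions -/

/-- **The region of `𝔍 = {J_v}` (an arithmetic line bundle on `F_mod`, d3's `IdealFamily F`) in the label `α` of the
relative portion `π` at `v_ℚ`**: at `p`, `ι_α(ϖ_{v_α}^{-n_{v_α}})·(R_I)^∼ ⊆ ⊗_β K_{v̲_β}` (the integral structure of the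
portion of `K`, multiplied in the factor `α` by the image of the global generator `ϖ_{v_α}^{-n} ∈ F_mod^×` through
`F_mod → K → K_{v̲_α}`); at `∞`, the unit polydisc of `⊗_{β,ℝ}ℂ` dilated by `e^{t_{w_α}}` in the factor `α`.
[claim: Mochizuki2012, status: disputed] -/
def relIdealCapsuleRegionAt (α : A) (J : IdealFamily F) :
    (q : RatPlace) → (π : Portion F A q) → (relPortionDatum σ τ A q π).Adm
  | Sum.inl (), π =>
      CapsuleDatum.Adm.comap (algebraMap F K)
        (archIdealPortionRegion K A (fun β => τ (packetInftyEquiv F (π β))) α (J.arch (packetInftyEquiv F (π α))))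
  | Sum.inr p, π =>
      haveI : Fact (p : ℕ).Prime := ⟨p.2⟩
      (relPortionDatum σ τ A (RatPlace.prime p) π).actAdm α
        (idealGenAt F (packetPrimeEquiv F p (π α)).1 (J.fin (packetPrimeEquiv F p (π α)).1))
        (CapsuleDatum.Adm.comap (algebraMap F K)
          (integralPortionRegion K A p (liftTuple σ A p (fun β => packetPrimeEquiv F p (π β)))))

/-- **Its portion log-volume is d3's per-place term at `π(α)`** (`t_{w_α}` at `∞`; at `p`:
`μ^log((R_I)^∼) + shift^rel_π(α, ϖ^{-n}) = 0 + θ_{v_α}(ϖ^{-n}) = n·log q_{v_α}/n_{v_α}` by part I's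
`relPortionDatum_shift_prime` and d3's `log_adicAbv_idealGenAt`). [claim: Mochizuki2012, status: disputed] -/
theorem relPortionDatum_logVol_relIdealCapsuleRegionAt (α : A) (J : IdealFamily F) (q : RatPlace) (π : Portion F A q) :
    (relPortionDatum σ τ A q π).logVol (relIdealCapsuleRegionAt σ τ A α J q π).1 = idealTerm F J (π α).1 := by
  rcases q with ⟨⟩ | p
  · show ((archPortion K A _).comap (algebraMap F K)).logVol
      (CapsuleDatum.Adm.comap (algebraMap F K) (archIdealPortionRegion K A _ α _)).1 = _
    rw [CapsuleDatum.logVol_admComap, archPortion_logVol_idealPortionRegion]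
    generalize π α = v
    rcases v with ⟨w | w, h⟩
    · rfl
    · exact absurd h (ratPlaceBelow_inr_ne_infty F w)
  · haveI : Fact (p : ℕ).Prime := ⟨p.2⟩
    show (relPortionDatum σ τ A (RatPlace.prime p) π).logVol
      ((relPortionDatum σ τ A (RatPlace.prime p) π).actAdm α _ (CapsuleDatum.Adm.comap (algebraMap F K)
        (integralPortionRegion K A p (liftTuple σ A p (fun β => packetPrimeEquiv F p (π β)))))).1 = _
    rw [CapsuleDatum.logVol_actAdm, relPortionDatum_shift_prime]
    rw [show (relPortionDatum σ τ A (RatPlace.prime p) π).logVol (CapsuleDatum.Adm.comap (algebraMap F K)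
        (integralPortionRegion K A p (liftTuple σ A p (fun β => packetPrimeEquiv F p (π β))))).1 = 0 from
      nonarchPortion_logVol_integralPortionRegion K A p _, zero_add]
    generalize π α = v
    rcases v with ⟨w | w, h⟩
    · exact absurd h (ratPlaceBelow_inl_ne_prime F w p)
    · show Real.log (NumberField.HeightOneSpectrum.adicAbv F w (idealGenAt F w (J.fin w) : F)) / (localDegree F w : ℝ) =
        (J.fin w : ℝ) * logNorm F w / localDegree F w
      rw [log_adicAbv_idealGenAt]

/-- **At every `v_ℚ` the relative `A`-packet log-volume of `𝔍`-in-label-`α` equals d3's `|A| = 1`, `K = F` packet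
log-volume of `𝔍`** (p416411's `haarIdealRegion`): `Σ_π (∏_β ω(π β))·term(π α) = Σ_v ω_v·term_v = Σ_v c_v·μ^log_v(J_v)`.
[claim: Mochizuki2012, status: disputed] -/
theorem relCapsulePacketLogVolume_relIdealCapsuleRegionAt (α : A) (J : IdealFamily F) (q : RatPlace) :
    relCapsulePacketLogVolume σ τ A q (relIdealCapsuleRegionAt σ τ A α J q) =
      haarPacketLogVolume F q ((haarIdealRegion F J).1 q) := by
  unfold relCapsulePacketLogVolume portionWeight
  simp_rw [relPortionDatum_logVol_relIdealCapsuleRegionAt]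
  rw [sum_pi_prod_mul_apply A (fun v : Packet F q => placeProbWeight F v.1) (fun v => idealTerm F J v.1)
    (sum_packet_placeProbWeight F q) α]
  simp only [haarPacketLogVolume, haarIdealRegion_apply]
  exact Finset.sum_congr rfl fun v _ => placeProbWeight_mul_idealTerm F J v.1

/-- At every `v_ℚ` it also equals d3's ABSOLUTE capsule log-volume of `𝔍`-in-label-`α` (p419946): the relative and the
absolute genuine `A`-packets give `𝔍` the same packet log-volumes. [claim: Mochizuki2012, status: disputed] -/
theorem relCapsulePacketLogVolume_relIdealCapsuleRegionAt_eq_capsule (α : A) (J : IdealFamily F) (q : RatPlace) :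
    relCapsulePacketLogVolume σ τ A q (relIdealCapsuleRegionAt σ τ A α J q) =
      capsulePacketLogVolume F A q (idealCapsuleRegionAt F A α J q) := by
  rw [relCapsulePacketLogVolume_relIdealCapsuleRegionAt, capsulePacketLogVolume_idealCapsuleRegionAt]

/-! ### The global region of `𝔍` and the degree clause -/

/-- **The region of `𝔍` in the label `α`** as a GLOBAL region of the relative `A`-packets ("zero log-volume for all but
finitely many `v_ℚ`": its packet log-volumes are those of p416411's `haarIdealRegion`). [claim: Mochizuki2012, status: disputed] -/
def relIdealCapsuleRegion (α : A) (J : IdealFamily F) : GlobalRegion (relCapsulePacketLogVolume σ τ A) :=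
  ⟨relIdealCapsuleRegionAt σ τ A α J, by
    have h := (haarIdealRegion F J).2
    refine h.subset fun q hq => ?_
    rw [Function.mem_support, relCapsulePacketLogVolume_relIdealCapsuleRegionAt] at hq
    exact Function.mem_support.mpr hq⟩

/-- Components of the global region of `𝔍`. [claim: Mochizuki2012, status: disputed] -/
@[simp] theorem relIdealCapsuleRegion_apply (α : A) (J : IdealFamily F) (q : RatPlace) :
    (relIdealCapsuleRegion σ τ A α J).1 q = relIdealCapsuleRegionAt σ τ A α J q := rfl

/-- It IS p422500's `relCapsuleIdealRegionAt … hA` whenever `2 ≤ |A|` (the `K`-slot integral structure is the same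
set). [claim: Mochizuki2012, status: disputed] -/
theorem relCapsuleIdealRegionAt_eq_relIdealCapsuleRegionAt (hA : 2 ≤ Fintype.card A) (α : A) (J : IdealFamily F)
    (q : RatPlace) : relCapsuleIdealRegionAt σ τ A hA α J q = relIdealCapsuleRegionAt σ τ A α J q := by
  rcases q with ⟨⟩ | p <;> rfl

/-- It IS p422500's global region `relCapsuleIdealRegion … hA` whenever `2 ≤ |A|`. [claim: Mochizuki2012, status: disputed] -/
theorem relCapsuleIdealRegion_eq_relIdealCapsuleRegion (hA : 2 ≤ Fintype.card A) (α : A) (J : IdealFamily F) :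
    relCapsuleIdealRegion σ τ A hA α J = relIdealCapsuleRegion σ τ A α J :=
  Subtype.ext (funext fun q => relCapsuleIdealRegionAt_eq_relIdealCapsuleRegionAt σ τ A hA α J q)

/-- **`μ^log_{A,𝕍_ℚ}(𝔍)` at the relative model `= μ^log_{𝕍_ℚ}(𝔍)` at d3's `|A| = 1`, `K = F` model.**
[claim: Mochizuki2012, status: disputed] -/
theorem globalLogVolume_relIdealCapsuleRegion_eq (α : A) (J : IdealFamily F) :
    globalLogVolume (relCapsulePacketLogVolume σ τ A) (relIdealCapsuleRegion σ τ A α J) =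
      globalLogVolume (haarPacketLogVolume F) (haarIdealRegion F J) := by
  unfold globalLogVolume
  exact finsum_congr fun q => relCapsulePacketLogVolume_relIdealCapsuleRegionAt σ τ A α J q

/-- **`μ^log_{A,𝕍_ℚ}(𝔍) = deg_F(𝔍)/[F:ℚ]`** at the relative genuine `A`-packets, for every `K ⊇ F_mod`, every section, every
finite nonempty `A` (`|A| = 1` included) and every label `α` (p416411 `globalLogVolume_haarIdealRegion`). [claim: Mochizuki2012, status: disputed] -/
theorem globalLogVolume_relIdealCapsuleRegion (α : A) (J : IdealFamily F) :
    globalLogVolume (relCapsulePacketLogVolume σ τ A) (relIdealCapsuleRegion σ τ A α J) =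
      J.deg / Module.finrank ℚ F := by
  rw [globalLogVolume_relIdealCapsuleRegion_eq, globalLogVolume_haarIdealRegion]

/-- The same with the tree's normalised degree `ndeg` ([IUTchIV] Def. 1.9 (i)): `μ^log_{A,𝕍_ℚ}(𝔍) = deg(𝔞_𝔍)` on the nose.
[claim: Mochizuki2012, status: disputed] -/
theorem globalLogVolume_relIdealCapsuleRegion_eq_ndeg (α : A) (J : IdealFamily F) :
    globalLogVolume (relCapsulePacketLogVolume σ τ A) (relIdealCapsuleRegion σ τ A α J) = ndeg F J.toADivisor := by
  rw [globalLogVolume_relIdealCapsuleRegion_eq, globalLogVolume_haarIdealRegion_eq_ndeg]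

/-- **IUTchIII:Prop3.9(iii)** (kurims p. 117) DEGREE CLAUSE AT THE RELATIVE GENUINE MODEL FOR CAPSULES OF EVERY SIZE
(rows REL39 part R3 / CAP39 part VIII; node IUTchIII:Prop3.9(iii)): for every extension of number fields `K ⊇ F_mod`, every
section of places, every finite nonempty label set `A` (`|A| = 1` included) and every label `α ∈ A`, abc-iut-L6-t4's `Prop39iii_degree (relCapsulePacketLogVolume σ τ A)
(relIdealCapsuleRegion σ τ A α) IdealFamily.deg` HOLDS with the normalisation constant `c = 1/[F_mod:ℚ]` — the SAME
constant as at `K = F_mod` (p416411, p419946): "the global log-volume `μ^log_{A,𝕍_ℚ}(𝔍)` is equal to the degree of the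
arithmetic line bundle determined by `𝔍` …, relative to a suitable normalization", the normalization being independent of
`K`, of the section and of the capsule (p422500's `prop39iii_degree_haarModelRelCapsules` without `2 ≤ |A|`).
[claim: Mochizuki2012, status: disputed] -/
theorem prop39iii_degree_haarModelRelCapsules_allSizes (α : A) :
    Prop39iii_degree (relCapsulePacketLogVolume σ τ A) (relIdealCapsuleRegion σ τ A α) IdealFamily.deg :=
  ⟨1 / Module.finrank ℚ F, div_pos one_pos (FinDivisor.finrank_pos (F := F)), fun J => by
    rw [globalLogVolume_relIdealCapsuleRegion, one_div, ← div_eq_inv_mul]⟩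

/-- The unit family `𝒪 = {𝒪_v}` in any label has global log-volume `0` at the relative model ("the log-volume of [the
integral structures] … is equal to zero", Prop. 3.9 (i)). [claim: Mochizuki2012, status: disputed] -/
theorem globalLogVolume_relIdealCapsuleRegion_unit (α : A) :
    globalLogVolume (relCapsulePacketLogVolume σ τ A) (relIdealCapsuleRegion σ τ A α IdealFamily.unit) = 0 := by
  rw [globalLogVolume_relIdealCapsuleRegion_eq, globalLogVolume_haarIdealRegion_unit]

/-- Relative models with the degree clause exist for every `K ⊇ F_mod` (sections of places exist).
[claim: Mochizuki2012, status: disputed] -/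
theorem exists_prop39iii_degree_haarModelRelCapsules_allSizes (α : A) :
    ∃ (σ : PlaceSection F K) (τ : InfinitePlace F → InfinitePlace K),
      (∀ w, (τ w).comap (algebraMap F K) = w) ∧
      Prop39iii_degree (relCapsulePacketLogVolume σ τ A) (relIdealCapsuleRegion σ τ A α) IdealFamily.deg := by
  obtain ⟨σ'⟩ := PlaceSection.nonempty F K
  exact ⟨σ', fun w => (InfinitePlace.comap_surjective (K := K) w).choose,
    fun w => (InfinitePlace.comap_surjective (K := K) w).choose_spec,
    prop39iii_degree_haarModelRelCapsules_allSizes σ' _ A α⟩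

include hτ in
/-- **Both clauses of Prop. 3.9 (iii) together at the relative genuine capsule model**: multiplying the region of `𝔍` in the
label `β` by `f ∈ F_mod^×` in ANY label `γ` leaves its global log-volume `deg_F(𝔍)/[F:ℚ]` unchanged (part I
`prop39iii_invariance_haarModelRelCapsules`). [claim: Mochizuki2012, status: disputed] -/
theorem globalLogVolume_relCapsulePacketAction_relIdealCapsuleRegion (β γ : A) (f : Fˣ) (J : IdealFamily F) :
    globalLogVolume (relCapsulePacketLogVolume σ τ A)
        (relCapsulePacketAction σ τ hτ A γ f (relIdealCapsuleRegion σ τ A β J)) = J.deg / Module.finrank ℚ F := by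
  rw [globalLogVolume_relCapsulePacketAction, globalLogVolume_relIdealCapsuleRegion]

end Literature.IUT.LogThetaLattice

end
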